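import Literature.AlgebraicGeometry.HodgeTheory.ChernCharacterLawsSpanTopDegree
import Summits.HodgeConjecture.HodgeConjecture.Theorems.EightfoldBlochSeedsChernCharacterOnBettiByName
import HarnessLib

/-!
# `stub_spanForOne` of the line `grothendieck_axiomatic` (stmt-HodgeConjecture-19780) reduced to the MIDDLE degrees: the Gysin
# generators `g_* 1_V`, `1 ≤ p ≤ dim X − 1`

Route `EightfoldBlochSeeds` (decl of record `Theses.EightfoldTwistedSheafSeeds.ChernCharacterOnBetti = Nonempty ChernCharacterBetti`), item
`stmt-HodgeConjecture-19780`, helper (`--supports`). HONEST FRAMING: nothing here proves 19780 / 18883 / H2 / HC_AV / HC_CM / HC; the registered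
stub `stub_spanForOne` (skeleton `Cruxes/ChernCharacterOnBetti/Lines/grothendieck_axiomatic.lean`, sha16 `5b9f6051b7bdccf8`) is REDUCED, not
closed; no definition, no named fact.

`stub_spanForOne : ∃ ch₀ : ChernDatum, ch₀.IsTopological ∧ ch₀.NonDegenerate ∧ ∀ {n X}, IsSmoothProjective n X → ∀ {p}, 0 < p →
algebraicClasses X p ≤ ℂ · {ch₀_p(E) : E a vector bundle}`. Of the positive degrees, two ranges are THEOREMS of the tree for every
lawful non-degenerate datum (`Literature/AlgebraicGeometry/HodgeTheory/ChernCharacterLawsSpanTopDegree`, `…/ChernCharacterLawsCoherent`):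
the TOP degree `p = dim X` (`ℂ · {ch_n(E)} = H²ⁿ`, a line containing `ch_n(e^*𝒪(-1)) ≠ 0`) and the EMPTY degrees `p > dim X`
(`H²ᵖ = 0`). What is left is `1 ≤ p ≤ dim X − 1`, where `Nᵖ H²ᵖ = ℂ · {g_* 1_V : g : V ⟶ X, V smooth projective of dimension dim X − p}`
(`algebraicClasses_eq_span_complexGysin_one`); so:

* `stub_spanForOne_of_forall_complexGysin_one_mem` — **`stub_spanForOne` VERBATIM follows from: ONE lawful non-degenerate datum `ch₀`
  such that, for every smooth projective `X`, every `1 ≤ p` and `1 ≤ d` with `d + p = dim X`, and every `g : V ⟶ X` from a smooth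
  projective `d`-fold, `g_* 1_V ∈ ℂ · {ch₀_p(E)}`;**
* `stub_spanForOne_of_forall_exists_chKZeroCoh_eq_smul` — **the `K`-theoretic form**: it suffices that each such `g_* 1_V` be, up to a
  non-zero scalar, `ch₀_p(y)` for a class `y ∈ K(X)` of coherent sheaves (`ChernDatum.chKZeroCoh`) — the LEADING TERM OF
  GROTHENDIECK–RIEMANN–ROCH for `g` (`y = Σ (−1)ⁱ [Rⁱ g_* 𝒪_V]`, scalar `λᵖ`; Fulton Thm. 15.2 in lowest codimension, Borel–Serre §7);
* `chernCharacterOnBetti_of_forall_complexGysin_one_mem` — consequently **the crux `ChernCharacterOnBetti` BY NAME follows from the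
  existence of such a datum** (`chernCharacterOnBetti_of_exists_isTopological_span` + `ChernDatum.IsTopological.algebraicClasses_le_span
  _of_spanForOne`).

[cite: Fulton1998, Thm. 15.2, Example 15.2.16 (b) and §19.1 Lemma 19.1.1] [cite: BorelSerre1958, §7] [cite: Deligne2000, §2 Remark (ii)]
[cite: Grothendieck1958, Thm. 1]
-/

noncomputable section

-- single-problem summit (Problem = Summit): the mandated namespace repeats `HodgeConjecture`.
set_option linter.dupNamespace false

open CategoryTheory AlgebraicGeometry
open Literature.AlgebraicGeometry.Motives Literature.AlgebraicGeometry.HodgeTheory Literature.AlgebraicGeometry.KTheory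
open Literature.AlgebraicTopology.SingularHomology

namespace Summit.HodgeConjecture.HodgeConjecture.Theorems

/-- **The positive-degree span law of a lawful non-degenerate datum from its middle-degree Gysin memberships**: if for every smooth
projective `X`, every `1 ≤ p`, `1 ≤ d` with `d + p = dim X` and every `g : V ⟶ X` from a smooth projective `d`-fold the class `g_* 1_V`
lies in `ℂ · {ch_p(E)}`, then `Nᵖ H²ᵖ(X(ℂ); ℂ) ⊆ ℂ · {ch_p(E)}` for every smooth projective `X` and every `p ≥ 1` (top degree and
empty degrees being theorems). [cite: Fulton1998, Example 15.2.16 (b) and §19.1 Lemma 19.1.1] [cite: VoisinHodgeI2002, Thm. 11.32] -/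
theorem algebraicClasses_le_span_of_forall_complexGysin_one_mem_middle (μ : OrientationFamily) {ch : ChernDatum}
    (h : ch.IsTopological) (hnd : ch.NonDegenerate)
    (H : ∀ {n : ℕ} {X : SchemeOver ℂ} (hX : IsSmoothProjective n X) {p d : ℕ} (_ : 0 < p) (_ : 0 < d) (hdp : d + p = n)
      (V : SchemeOver ℂ) (hV : IsSmoothProjective d V) (g : V ⟶ X),
      complexGysin μ hV hX g (a := 0) (b := 2 * p) (by omega) (singularCohomology.one ℂ (ComplexPoints V)) ∈
        Submodule.span ℂ {c | ∃ E : X.left.Modules, IsVectorBundle E ∧ ch X E p = c})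
    {n : ℕ} {X : SchemeOver ℂ} (hX : IsSmoothProjective n X) {p : ℕ} (hp : 0 < p) :
    algebraicClasses X p ≤ Submodule.span ℂ {c | ∃ E : X.left.Modules, IsVectorBundle E ∧ ch X E p = c} := by
  rcases lt_trichotomy p n with hpn | rfl | hpn
  · exact ChernDatum.algebraicClasses_le_span_of_forall_complexGysin_one_mem ch μ hX (d := n - p) (by omega)
      fun V hV g ↦ H hX hp (by omega) (by omega) V hV g
  · exact h.algebraicClasses_le_span_ch_of_degree_top hnd hX hp
  · exact ChernDatum.algebraicClasses_le_span_of_dim_lt ch hX hpn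

/-- **`stub_spanForOne` VERBATIM (skeleton `Lines/grothendieck_axiomatic.lean`, sha16 `5b9f6051b7bdccf8`) from the middle-degree Gysin
memberships of ONE lawful non-degenerate datum.** [cite: Fulton1998, Example 15.2.16 (b) and §19.1 Lemma 19.1.1]
[cite: Deligne2000, §2 Remark (ii)] -/
theorem stub_spanForOne_of_forall_complexGysin_one_mem (μ : OrientationFamily)
    (hex : ∃ ch₀ : ChernDatum, ch₀.IsTopological ∧ ch₀.NonDegenerate ∧
      ∀ {n : ℕ} {X : SchemeOver ℂ} (hX : IsSmoothProjective n X) {p d : ℕ} (_ : 0 < p) (_ : 0 < d) (hdp : d + p = n)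
        (V : SchemeOver ℂ) (hV : IsSmoothProjective d V) (g : V ⟶ X),
        complexGysin μ hV hX g (a := 0) (b := 2 * p) (by omega) (singularCohomology.one ℂ (ComplexPoints V)) ∈
          Submodule.span ℂ {c | ∃ E : X.left.Modules, IsVectorBundle E ∧ ch₀ X E p = c}) :
    ∃ ch₀ : ChernDatum, ch₀.IsTopological ∧ ch₀.NonDegenerate ∧
      ∀ {n : ℕ} {X : SchemeOver ℂ}, IsSmoothProjective n X → ∀ {p : ℕ}, 0 < p →
        algebraicClasses X p ≤ Submodule.span ℂ {c | ∃ E : X.left.Modules, IsVectorBundle E ∧ ch₀ X E p = c} := by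
  obtain ⟨ch₀, h₀, hnd₀, H⟩ := hex
  exact ⟨ch₀, h₀, hnd₀, fun {n} {X} hX {p} hp ↦
    algebraicClasses_le_span_of_forall_complexGysin_one_mem_middle μ h₀ hnd₀
      (fun {n} {X} hX {p} {d} hp hd hdp V hV g ↦ H hX hp hd hdp V hV g) hX hp⟩

/-- **`stub_spanForOne` VERBATIM from the `K`-theoretic (Grothendieck–Riemann–Roch leading term) shape**: ONE lawful non-degenerate
datum `ch₀` such that every middle-degree Gysin generator `g_* 1_V` is, up to a non-zero scalar, `ch₀_p(y)` for some `y ∈ K(X)`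
(`ChernDatum.chKZeroCoh`; in print `y = R g_* 𝒪_V`, scalar `λᵖ`). [cite: Fulton1998, Thm. 15.2 and Example 15.2.16 (b)]
[cite: BorelSerre1958, §7] -/
theorem stub_spanForOne_of_forall_exists_chKZeroCoh_eq_smul (μ : OrientationFamily)
    (hex : ∃ ch₀ : ChernDatum, ∃ h₀ : ch₀.IsTopological, ch₀.NonDegenerate ∧
      ∀ {n : ℕ} {X : SchemeOver ℂ} (hX : IsSmoothProjective n X) {p d : ℕ} (_ : 0 < p) (_ : 0 < d) (hdp : d + p = n)
        (V : SchemeOver ℂ) (hV : IsSmoothProjective d V) (g : V ⟶ X), ∃ (y : KZeroCoh X.left) (c : ℂ), c ≠ 0 ∧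
        ChernDatum.chKZeroCoh ch₀ h₀.ch_shortExact hX p y =
          c • complexGysin μ hV hX g (a := 0) (b := 2 * p) (by omega) (singularCohomology.one ℂ (ComplexPoints V))) :
    ∃ ch₀ : ChernDatum, ch₀.IsTopological ∧ ch₀.NonDegenerate ∧
      ∀ {n : ℕ} {X : SchemeOver ℂ}, IsSmoothProjective n X → ∀ {p : ℕ}, 0 < p →
        algebraicClasses X p ≤ Submodule.span ℂ {c | ∃ E : X.left.Modules, IsVectorBundle E ∧ ch₀ X E p = c} := by
  obtain ⟨ch₀, h₀, hnd₀, H⟩ := hex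
  refine stub_spanForOne_of_forall_complexGysin_one_mem μ ⟨ch₀, h₀, hnd₀, fun {n} {X} hX {p} {d} hp hd hdp V hV g ↦ ?_⟩
  obtain ⟨y, c, hc, hy⟩ := H hX hp hd hdp V hV g
  have hmem := ChernDatum.chKZeroCoh_mem_span ch₀ h₀.ch_shortExact hX p y
  rw [hy] at hmem
  have h' := Submodule.smul_mem _ c⁻¹ hmem
  rwa [smul_smul, inv_mul_cancel₀ hc, one_smul] at h'

/-- **The crux `ChernCharacterOnBetti` BY NAME from ONE lawful non-degenerate datum with the middle-degree Gysin memberships**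
(`chernCharacterOnBetti_of_exists_isTopological_span`: algebraicity and degree `0` are automatic; the span law in degrees `≥ 1` from
the previous reductions). [cite: Fulton1998, §15.1, Thm. 15.2, Example 15.2.16 (b) and Prop. 19.1.2] [cite: Grothendieck1958, Thm. 1] -/
theorem chernCharacterOnBetti_of_forall_complexGysin_one_mem (μ : OrientationFamily)
    (hex : ∃ ch₀ : ChernDatum, ch₀.IsTopological ∧ ch₀.NonDegenerate ∧
      ∀ {n : ℕ} {X : SchemeOver ℂ} (hX : IsSmoothProjective n X) {p d : ℕ} (_ : 0 < p) (_ : 0 < d) (hdp : d + p = n)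
        (V : SchemeOver ℂ) (hV : IsSmoothProjective d V) (g : V ⟶ X),
        complexGysin μ hV hX g (a := 0) (b := 2 * p) (by omega) (singularCohomology.one ℂ (ComplexPoints V)) ∈
          Submodule.span ℂ {c | ∃ E : X.left.Modules, IsVectorBundle E ∧ ch₀ X E p = c}) :
    Summit.HodgeConjecture.HodgeConjecture.Theses.EightfoldTwistedSheafSeeds.ChernCharacterOnBetti := by
  obtain ⟨ch₀, h₀, -, hspan⟩ := stub_spanForOne_of_forall_complexGysin_one_mem μ hex
  exact chernCharacterOnBetti_of_exists_isTopological_span ⟨ch₀, h₀, fun {n} {X} hX {p} hp ↦ hspan hX hp⟩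

/-- **The span law holds UNCONDITIONALLY on smooth projective curves and points** for every lawful non-degenerate datum — the first
instances of `stub_spanForOne`'s conclusion that are theorems (`ChernDatum.IsTopological.algebraicClasses_le_span_ch_of_dim_le_one`).
[cite: Fulton1998, Example 15.2.16 (b)] [cite: VoisinHodgeI2002, Thm. 11.32] -/
theorem spanForOne_conclusion_of_dim_le_one {ch : ChernDatum} (h : ch.IsTopological) (hnd : ch.NonDegenerate)
    {n : ℕ} {X : SchemeOver ℂ} (hX : IsSmoothProjective n X) (hn : n ≤ 1) {p : ℕ} (hp : 0 < p) :
    algebraicClasses X p ≤ Submodule.span ℂ {c | ∃ E : X.left.Modules, IsVectorBundle E ∧ ch X E p = c} :=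
  h.algebraicClasses_le_span_ch_of_dim_le_one hnd hX hn hp

end Summit.HodgeConjecture.HodgeConjecture.Theorems

end
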